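import Summits.AtomisticToContinuum.FouriersLaw.Theses.ParityLiouvilleSeed

/-!
# Birth skeleton (BC3) for the crux `ParityLiouvilleSeed.NessRegularity`
(crux item `stmt-AtomisticToContinuum-13977`, rank 3, route `route-AtomisticToContinuum-ParityLiouvilleSeed`,
sub-problem `AtomisticToContinuum/FouriersLaw`; registrar `planner-skel-stmt-AtomisticToContinuum-13977-0`, 2026-08-17)

Crux (FIXED, concluded BY NAME below): `NessRegularity` — for `pinnedChain ω₂ lam β γ` (all `> 0`) and `T_L, T_R > 0`
there are `T > 0`, a SHIFT-INVARIANT infinite-volume Gibbs state `μ_T` and `C < ∞` with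
`H(μ|_Λ ‖ μ_T|_Λ) ≤ C(n+1)` for every `N`, every weak steady state `μ` of the `N`-chain and every box
`Λ = {a,…,a+n} ⊆ {0,…,N−1}` (N-uniform regularity of the NESS; makes bulk window limits regular).

## The line (the route's own foreseen two-layer split, typed): ENTROPY PRODUCTION SEEDS, HYPOELLIPTIC BULK SPREADS,
## LOG-SOBOLEV CONVERTS

`NessRegularity ⇐ S1 ∧ S2 ∧ S3 ∧ S4` (`NessRegularity_of`, kernel-checked, real proof):
* **S1 `stub_temperedGibbsState`** (L) — a tempered, translation-invariant DLR state `μ_T` exists at every `T > 0`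
  (inhabits the `∃ μT`; the reference is chosen at the mean temperature `T = (T_L+T_R)/2`).
* **S2 `stub_bathFisherBudget`** (L, the N-uniform seed) — stationary entropy balance
  `Σ_b γT_b Ĩ_b = J̃(1/T_R − 1/T_L)` + the a-priori flux bound `|J̃| ≤ γ max T_b` ⇒ the momentum law at each bath site has
  relative Fisher information `≤ C₀` w.r.t. the bath Maxwellian, uniformly in `N` (= the route's `BathFisherBudget`).
* **S3 `stub_fisherNoPileUp`** (XL, HARDEST, open) — given the reference and the budget, box marginals of the NESS have
  relative Fisher information `≤ C(n+1)` w.r.t. `μ_T|_Λ`, uniformly in `N` (= the route's `BulkFisherNoPileUp`: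
  N-uniform quantitative hypoellipticity along the chain).
* **S4 `stub_boxLSI`** (M–L, known) — dimension-free logarithmic Sobolev inequality for the box marginals of the uniformly
  log-concave reference (Bakry–Émery + Brascamp–Lieb), in `klDiv` form: `H ≤ c·I` with `c` independent of the box.
* `NessRegularity_of` — fix parameters and `T_L, T_R`; `T := (T_L+T_R)/2`; S1 gives `μ_T`; S2 gives the budget; S3 turns it
  into box Fisher bounds with densities `f`; the NESS box marginal is a probability measure (push-forward of the steady
  state, `IsSteadyState.1`), so S4 applies and `klDiv ≤ c·(C(n+1)) = (cC)(n+1)` with `cC ≠ ⊤`.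

Typing notes. Box marginal of the NESS and `boxMarginal (a:ℤ) n μT` both live on `Fin (n+1) → ℝ × ℝ` (verbatim the crux's
spelling). Densities are positive `C¹` functions with `Measure.withDensity (ENNReal.ofReal ∘ f)`; Fisher integrands are
Euclidean (`fderiv … (Pi.single i (1,0))`, `(Pi.single i (0,1))`), every real integral that is bounded is also asserted
`Integrable` (no Bochner-junk vacuity, checklist 4c(ii)); constants live in `ℝ≥0∞` with `≠ ⊤` exactly as in the crux.
Harmonic calibration (`lam = β = 0`, RiederLebowitzLieb1967 Gaussian NESS): S1–S4 and the crux all HOLD there — this crux is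
not where anharmonicity enters the route (that is `ZeroCurrentRigidity`), consistent with the route header's NUMBERS.

Disproof used: none exists — `ledger crux ls stmt-AtomisticToContinuum-13977` lists no workfiles (no `Disproof.lean`, no
`Negative/` lemma, no ideas) at registration time; nothing to honour or avoid yet. Negatives index: no refuted statement of
the summit concerns NESS regularity / entropy bounds.

Audit: `lean check` rc 0, 4 sorries = the 4 `stub_*` and nowhere else; `NessRegularity_of` takes the four stubs BY NAME
(`Registered.stub_*`, verbatim abbrevs, definitional `example`s below) and concludes
`Summit.AtomisticToContinuum.FouriersLaw.Theses.ParityLiouvilleSeed.NessRegularity` by name. BC3 probes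
(`stub → NessRegularity`, `stub → FouriersLaw` by `first | exact? | simpa | aesop`) fail 8/8 (registrar NOTES.md).
-/

noncomputable section

namespace Summit.AtomisticToContinuum.FouriersLaw.Cruxes.NessRegularity.Birth

open MeasureTheory ProbabilityTheory InformationTheory Filter Topology Set
open scoped ENNReal NNReal BigOperators ContDiff
open Literature.MathematicalPhysics.KineticTheory.HeatConduction

set_option linter.unusedVariables false

/-! ## S1 — the reference: a tempered shift-invariant Gibbs state -/

/-- **S1 `stub_temperedGibbsState`** (size L; the reference). For `ω₂ > 0`, `lam, β ≥ 0` and every `T > 0` the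
infinite pinned chain has a TEMPERED, TRANSLATION-INVARIANT infinite-volume Gibbs (DLR) state `μ_T`
(`IsChainGibbsMeasure`, specification `chainSpecification = gibbsSpecOfPotential volume chainPotential chainSupp T⁻¹`)
all of whose one-site polynomial moments are finite. Why plausibly true: the one-body part `p²/2 + ω₂q²/2 + lam q⁴/4`
is (super)stable and coercive and `V ≥ 0`, so every kernel `γ_Λ(·|η)` is a genuine probability measure (`0 < Z_Λ(η) < ∞`)
with Gaussian-or-better tails uniformly in tempered `η` (Ruelle's superstability estimates); the thermodynamic limit of
the free / periodic finite-volume Gibbs measures along boxes exists by tightness and is DLR and shift-invariant (1-d,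
nearest neighbour: Cesàro-average over translates of any tempered limit point; in d = 1 the tempered Gibbs state is in
fact unique — Dobrushin / Papangelou / Georgii Ch. 8, 11 — but uniqueness is NOT claimed). At `lam = β = 0` it is the
explicit stationary Gaussian (massive discrete free field ⊗ Maxwellian). The inhabitant of `NessRegularity`'s `∃ μT`.
Leans on: `Literature.Probability.LatticeModels.gibbsSpecOfPotential` / `IsGibbsMeasure` (DLR in the junk-free
`lintegral` form), `OscillatorChain.chainSpecification`, `CondB2`-type normalisability; Mathlib Prokhorov
(`MeasureTheory.isCompact_closure_of_isTightMeasureSet`-style API). [LanfordLebowitzLieb1977 §4; Ruelle 1976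
(superstable interactions, probability estimates); Georgii2011 Ch. 4 (existence), Ch. 8/11 (1-d)] -/
theorem stub_temperedGibbsState :
    ∀ ω₂ lam β γ : ℝ, 0 < ω₂ → 0 ≤ lam → 0 ≤ β → ∀ T : ℝ, 0 < T →
      ∃ μT : Measure ChainConfig,
        (pinnedChain ω₂ lam β γ).IsChainGibbsMeasure T μT ∧ IsShiftInvariant μT ∧
          ∀ m : ℕ, Integrable (fun σ : ChainConfig => |(σ 0).1| ^ m + |(σ 0).2| ^ m) μT := by
  sorry

/-! ## S2 — the N-uniform seed: bath Fisher budget from entropy production -/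

/-- **S2 `stub_bathFisherBudget`** (size L; the N-UNIFORM SEED — the only a-priori information the baths give for free).
For all parameters `> 0` and `T_L, T_R > 0` there is `C₀ = C₀(γ, T_L, T_R)` such that for EVERY `N` and EVERY weak steady
state `μ` of the `N`-chain, the law of the momentum at a bath site `b` (`b = 0` at `T_L`, `b = N-1` at `T_R`) has a
positive `C¹` density `g` w.r.t. the bath Maxwellian `𝒩(0, T_b)` with relative Fisher information
`∫ g′²/g d𝒩(0,T_b) ≤ C₀` — uniformly in `N`. Why plausibly true (entropy production pays): by `NessUnique_holds` (in tree)
`μ` is the CEHR invariant measure, with smooth positive density `ρ` and exponential moments at fixed `N`; testing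
stationarity `L*ρ = 0` against `log ρ` (Liouville kills the Hamiltonian part) and against `H` gives the stationary entropy
balance `Σ_b γ T_b Ĩ_b = J̃ (1/T_R − 1/T_L) =: σ_N ≥ 0`, `Ĩ_b = ∫ (∂_{p_b} log ρ + p_b/T_b)² dμ` the partial relative Fisher
informations and `J̃ = γ(T_L − μ(p_0²)) = γ(μ(p_{N−1}²) − T_R)` the per-bond flux, whence A PRIORI `|J̃| ≤ γ max(T_L,T_R)`
and `Ĩ_b ≤ max(T_L,T_R)|1/T_R − 1/T_L|/T_b` with NO `N`-dependence (EckmannPilletReyBellet1999b Thm 'entropy production';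
BonettoLebowitzReyBellet2000 §5.2 (25)–(27)); the marginal Fisher information of `Law(p_b)` is `≤ Ĩ_b` (convexity of
`(u,v) ↦ u²/v` / data processing), and the 1-d marginal of the smooth, exponentially integrable `ρ` has a positive `C¹`
density. Expected value `C₀ = max(T_L,T_R)·|T_R⁻¹ − T_L⁻¹|/min(T_L,T_R)`; `N = 1` (both baths on one site, Gibbs at
`(T_L+T_R)/2`) is an explicit finite constant. Calibration: holds verbatim at `lam = β = 0` (RiederLebowitzLieb1967 Gaussian
NESS). Same lever as `Cruxes/BoundaryKubo/Lines/fisher_budget.lean` S5 (different crux, fixed `N` there). Leans on: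
`NessUnique_holds`, `CuneoEckmannHairerReyBellet2018_smoothDensity_holds` / `_H2_holds` (LangevinChain cone, NOT imported
here), `generator_hamiltonian`, Gaussian LSI is NOT needed at this stage. [EckmannPilletReyBellet1999b; BonettoLebowitzReyBellet2000
§5.2; Carmona2007] -/
theorem stub_bathFisherBudget :
    ∀ ω₂ lam β γ : ℝ, 0 < ω₂ → 0 < lam → 0 < β → 0 < γ → ∀ T_L T_R : ℝ, 0 < T_L → 0 < T_R →
      ∃ C₀ : ℝ, ∀ (N : ℕ) (μ : Measure (PhaseSpace N)),
        (pinnedChain ω₂ lam β γ).IsSteadyState N T_L T_R μ →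
          ∀ (b : Fin N) (Tb : ℝ), (b.val = 0 ∧ Tb = T_L) ∨ (b.val = N - 1 ∧ Tb = T_R) →
            ∃ g : ℝ → ℝ, ContDiff ℝ 1 g ∧ (∀ t, 0 < g t) ∧
              μ.map (fun x => x.2 b) =
                (gaussianReal 0 Tb.toNNReal).withDensity (fun t => ENNReal.ofReal (g t)) ∧
              Integrable (fun t => deriv g t ^ 2 / g t) (gaussianReal 0 Tb.toNNReal) ∧
              ∫ t, deriv g t ^ 2 / g t ∂(gaussianReal 0 Tb.toNNReal) ≤ C₀ := by
  sorry

/-! ## S3 — no pile-up: N-uniform box Fisher bounds in the deterministic bulk (HARDEST) -/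

/-- **S3 `stub_fisherNoPileUp`** (HARDEST, size XL, the open input; = the route's foreseen `BulkFisherNoPileUp`).
Fix a tempered shift-invariant Gibbs reference `μ_T` (S1's output, any `T > 0`) and assume the N-uniform bath Fisher budget
(S2's conclusion, verbatim). Then there is `C < ∞` such that for every `N`, every weak steady state `μ` of the `N`-chain and
every box `Λ = {a,…,a+n} ⊆ {0,…,N−1}`, the box marginal of `μ` has a positive `C¹` density `f` w.r.t. the reference box
marginal `μ_T|_Λ` whose (Euclidean) relative Fisher information is at most `C(n+1)`: regularity injected at the two bath
momenta does NOT pile up at the contacts but spreads through the deterministic bulk at bounded density per site. Why it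
might be true: at fixed `N` hypoellipticity (Hörmander brackets from the two ends, in tree) transports the bath dissipation to
every coordinate; the claim is the QUANTITATIVE, `N`-UNIFORM version along the chain (Villani2009 §9.2-type hypocoercive
functional with site weights / commutator ladder `[∂_{p_k}, X_H] = ∂_{q_k}`, `[∂_{q_k}, X_H] ∼ V″·(∂_{p_{k±1}} − ∂_{p_k})`
propagating one site per bracket; BernardinOlla2005 / Bernardin2014 Lemma 3 prove the entropy analogue WITH bulk noise).
Why it might fail: no N-uniform a-priori estimate exists for any Hamiltonian-bulk NESS; Fisher information could concentrate
in boundary layers of width growing with `N`; the harmonic member (`lam = β = 0`) is the calibration — there the NESS is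
Gaussian with covariance uniformly comparable to Gibbs (RiederLebowitzLieb1967), so the bound HOLDS although transport is
ballistic: this stub is NOT where anharmonicity enters the route (that is ZeroCurrentRigidity). This is the stub a
disprover should attack first (cheapest falsifier: `N`-growth of the one-site Fisher information at the chain CENTRE in
nonequilibrium MD, `N = 16…256`). Leans on: `OscillatorChain.isBracketGenerating_hormanderFamily` (fixed-`N` pattern),
`boxMarginal`, S2. [Villani2009 §9.2; BernardinOlla2005; Bernardin2014 §2; EckmannPilletReyBellet1999b; Hairer2009] -/
theorem stub_fisherNoPileUp :
    ∀ ω₂ lam β γ : ℝ, 0 < ω₂ → 0 < lam → 0 < β → 0 < γ → ∀ T_L T_R : ℝ, 0 < T_L → 0 < T_R →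
      ∀ (T : ℝ) (μT : Measure ChainConfig), 0 < T →
        (pinnedChain ω₂ lam β γ).IsChainGibbsMeasure T μT → IsShiftInvariant μT →
        (∀ m : ℕ, Integrable (fun σ : ChainConfig => |(σ 0).1| ^ m + |(σ 0).2| ^ m) μT) →
        (∃ C₀ : ℝ, ∀ (N : ℕ) (μ : Measure (PhaseSpace N)),
          (pinnedChain ω₂ lam β γ).IsSteadyState N T_L T_R μ →
            ∀ (b : Fin N) (Tb : ℝ), (b.val = 0 ∧ Tb = T_L) ∨ (b.val = N - 1 ∧ Tb = T_R) →
              ∃ g : ℝ → ℝ, ContDiff ℝ 1 g ∧ (∀ t, 0 < g t) ∧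
                μ.map (fun x => x.2 b) =
                  (gaussianReal 0 Tb.toNNReal).withDensity (fun t => ENNReal.ofReal (g t)) ∧
                Integrable (fun t => deriv g t ^ 2 / g t) (gaussianReal 0 Tb.toNNReal) ∧
                ∫ t, deriv g t ^ 2 / g t ∂(gaussianReal 0 Tb.toNNReal) ≤ C₀) →
        ∃ C : ℝ≥0∞, C ≠ ⊤ ∧ ∀ (N : ℕ) (μ : Measure (PhaseSpace N)),
          (pinnedChain ω₂ lam β γ).IsSteadyState N T_L T_R μ → ∀ (a n : ℕ) (h : a + (n + 1) ≤ N),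
            ∃ f : (Fin (n + 1) → ℝ × ℝ) → ℝ, ContDiff ℝ 1 f ∧ (∀ y, 0 < f y) ∧
              μ.map (fun x => fun i : Fin (n + 1) =>
                  (x.1 (Fin.castLE h (Fin.natAdd a i)), x.2 (Fin.castLE h (Fin.natAdd a i)))) =
                (boxMarginal (a : ℤ) n μT).withDensity (fun y => ENNReal.ofReal (f y)) ∧
              Integrable (fun y => (∑ i : Fin (n + 1), ((fderiv ℝ f y (Pi.single i ((1 : ℝ), (0 : ℝ)))) ^ 2 +
                  (fderiv ℝ f y (Pi.single i ((0 : ℝ), (1 : ℝ)))) ^ 2)) / f y)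
                (boxMarginal (a : ℤ) n μT) ∧
              ENNReal.ofReal (∫ y, (∑ i : Fin (n + 1), ((fderiv ℝ f y (Pi.single i ((1 : ℝ), (0 : ℝ)))) ^ 2 +
                  (fderiv ℝ f y (Pi.single i ((0 : ℝ), (1 : ℝ)))) ^ 2)) / f y
                ∂(boxMarginal (a : ℤ) n μT)) ≤ C * (n + 1) := by
  sorry

/-! ## S4 — dimension-free log-Sobolev inequality for the reference's box marginals -/

/-- **S4 `stub_boxLSI`** (size M–L; known mathematics — the Fisher-to-entropy conversion, dimension-free).
For `ω₂ > 0`, `lam, β ≥ 0`, `T > 0` and a tempered shift-invariant Gibbs state `μ_T`, there is `c < ∞` (expected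
`c = T / (2 min(1, ω₂))`) such that for EVERY box `Λ = {a,…,a+n}` and every positive `C¹` probability density `f` w.r.t. the
box marginal `μ_T|_Λ` with integrable Fisher integrand, `H(f μ_T|_Λ ‖ μ_T|_Λ) ≤ c · I(f μ_T|_Λ ‖ μ_T|_Λ)` — a logarithmic
Sobolev inequality with constant INDEPENDENT of `|Λ|`. Why plausibly true: `H_Λ/T` is UNIFORMLY CONVEX
(`∂²_p = 1`, `U″ = ω₂ + 3 lam q² ≥ ω₂`, `V″ = 1 + 3βr² ≥ 0` contributes a positive-semidefinite graph Laplacian), so every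
finite-volume kernel `γ_{Λ'}(·|η)` is `κ`-log-concave with `κ = min(1,ω₂)/T` uniformly in `Λ' ⊇ Λ` and `η`; marginals of
`κ`-log-concave measures are `κ`-log-concave (Prékopa–Leindler / BrascampLieb1976 Thm 4.3) and the class is weakly closed,
so `μ_T|_Λ = lim_{Λ'↑ℤ}` (1-d insensitivity to tempered boundary conditions) is `κ`-log-concave; Bakry–Émery then gives
`Ent(f) ≤ (2κ)⁻¹ ∫ |∇f|²/f` for smooth positive probability densities, i.e. the claim with Mathlib's `klDiv`
(`klDiv (f·ν) ν = ∫ f log f dν` for probability measures, `llr`/`rnDeriv_withDensity`). The Euclidean Fisher integrand is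
spelled with `fderiv … (Pi.single i (1,0))`, `(Pi.single i (0,1))` (NOT the operator norm of `fderiv` for the sup-norm on
`Fin (n+1) → ℝ × ℝ`, which would cost a dimension factor). Calibration: at `lam = β = 0` it is the Gaussian LSI (Gross).
Leans on: Mathlib `InformationTheory.klDiv`, `Measure.withDensity`, `rnDeriv_withDensity`; no LSI in Mathlib yet (the
Bakry–Émery `Γ₂` computation in finite dimension is the work). [BakryEmery1985; BrascampLieb1976 Thm 4.3; Ledoux2001 Ch. 5;
Gross1975] -/
theorem stub_boxLSI :
    ∀ ω₂ lam β γ : ℝ, 0 < ω₂ → 0 ≤ lam → 0 ≤ β → ∀ (T : ℝ) (μT : Measure ChainConfig), 0 < T →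
      (pinnedChain ω₂ lam β γ).IsChainGibbsMeasure T μT → IsShiftInvariant μT →
        (∀ m : ℕ, Integrable (fun σ : ChainConfig => |(σ 0).1| ^ m + |(σ 0).2| ^ m) μT) →
        ∃ c : ℝ≥0∞, c ≠ ⊤ ∧ ∀ (a : ℤ) (n : ℕ) (f : (Fin (n + 1) → ℝ × ℝ) → ℝ),
          ContDiff ℝ 1 f → (∀ y, 0 < f y) →
          IsProbabilityMeasure ((boxMarginal a n μT).withDensity (fun y => ENNReal.ofReal (f y))) →
          Integrable (fun y => (∑ i : Fin (n + 1), ((fderiv ℝ f y (Pi.single i ((1 : ℝ), (0 : ℝ)))) ^ 2 +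
              (fderiv ℝ f y (Pi.single i ((0 : ℝ), (1 : ℝ)))) ^ 2)) / f y)
            (boxMarginal a n μT) →
          klDiv ((boxMarginal a n μT).withDensity (fun y => ENNReal.ofReal (f y))) (boxMarginal a n μT) ≤
            c * ENNReal.ofReal (∫ y, (∑ i : Fin (n + 1), ((fderiv ℝ f y (Pi.single i ((1 : ℝ), (0 : ℝ)))) ^ 2 +
                (fderiv ℝ f y (Pi.single i ((0 : ℝ), (1 : ℝ)))) ^ 2)) / f y
              ∂(boxMarginal a n μT)) := by
  sorry


/-! ## Name-keyed statements of the stubs (the hypotheses of the composition, BY NAME)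

`#h21_check_skeleton` admits as hypotheses of `NessRegularity_of` only registered obligations / declared stubs by name;
each `Registered.stub_X : Prop` is the statement of `stub_X` VERBATIM (generated from one source string per stub by the
registrar's `gen_birth.py`; the identity is checked definitionally by the `example`s that follow). -/
namespace Registered

/-- Statement of `stub_temperedGibbsState` (verbatim), keyed by the registered stub name. -/
abbrev stub_temperedGibbsState : Prop :=
    ∀ ω₂ lam β γ : ℝ, 0 < ω₂ → 0 ≤ lam → 0 ≤ β → ∀ T : ℝ, 0 < T →
      ∃ μT : Measure ChainConfig,
        (pinnedChain ω₂ lam β γ).IsChainGibbsMeasure T μT ∧ IsShiftInvariant μT ∧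
          ∀ m : ℕ, Integrable (fun σ : ChainConfig => |(σ 0).1| ^ m + |(σ 0).2| ^ m) μT

/-- Statement of `stub_bathFisherBudget` (verbatim), keyed by the registered stub name. -/
abbrev stub_bathFisherBudget : Prop :=
    ∀ ω₂ lam β γ : ℝ, 0 < ω₂ → 0 < lam → 0 < β → 0 < γ → ∀ T_L T_R : ℝ, 0 < T_L → 0 < T_R →
      ∃ C₀ : ℝ, ∀ (N : ℕ) (μ : Measure (PhaseSpace N)),
        (pinnedChain ω₂ lam β γ).IsSteadyState N T_L T_R μ →
          ∀ (b : Fin N) (Tb : ℝ), (b.val = 0 ∧ Tb = T_L) ∨ (b.val = N - 1 ∧ Tb = T_R) →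
            ∃ g : ℝ → ℝ, ContDiff ℝ 1 g ∧ (∀ t, 0 < g t) ∧
              μ.map (fun x => x.2 b) =
                (gaussianReal 0 Tb.toNNReal).withDensity (fun t => ENNReal.ofReal (g t)) ∧
              Integrable (fun t => deriv g t ^ 2 / g t) (gaussianReal 0 Tb.toNNReal) ∧
              ∫ t, deriv g t ^ 2 / g t ∂(gaussianReal 0 Tb.toNNReal) ≤ C₀

/-- Statement of `stub_fisherNoPileUp` (verbatim), keyed by the registered stub name. -/
abbrev stub_fisherNoPileUp : Prop :=
    ∀ ω₂ lam β γ : ℝ, 0 < ω₂ → 0 < lam → 0 < β → 0 < γ → ∀ T_L T_R : ℝ, 0 < T_L → 0 < T_R →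
      ∀ (T : ℝ) (μT : Measure ChainConfig), 0 < T →
        (pinnedChain ω₂ lam β γ).IsChainGibbsMeasure T μT → IsShiftInvariant μT →
        (∀ m : ℕ, Integrable (fun σ : ChainConfig => |(σ 0).1| ^ m + |(σ 0).2| ^ m) μT) →
        (∃ C₀ : ℝ, ∀ (N : ℕ) (μ : Measure (PhaseSpace N)),
          (pinnedChain ω₂ lam β γ).IsSteadyState N T_L T_R μ →
            ∀ (b : Fin N) (Tb : ℝ), (b.val = 0 ∧ Tb = T_L) ∨ (b.val = N - 1 ∧ Tb = T_R) →
              ∃ g : ℝ → ℝ, ContDiff ℝ 1 g ∧ (∀ t, 0 < g t) ∧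
                μ.map (fun x => x.2 b) =
                  (gaussianReal 0 Tb.toNNReal).withDensity (fun t => ENNReal.ofReal (g t)) ∧
                Integrable (fun t => deriv g t ^ 2 / g t) (gaussianReal 0 Tb.toNNReal) ∧
                ∫ t, deriv g t ^ 2 / g t ∂(gaussianReal 0 Tb.toNNReal) ≤ C₀) →
        ∃ C : ℝ≥0∞, C ≠ ⊤ ∧ ∀ (N : ℕ) (μ : Measure (PhaseSpace N)),
          (pinnedChain ω₂ lam β γ).IsSteadyState N T_L T_R μ → ∀ (a n : ℕ) (h : a + (n + 1) ≤ N),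
            ∃ f : (Fin (n + 1) → ℝ × ℝ) → ℝ, ContDiff ℝ 1 f ∧ (∀ y, 0 < f y) ∧
              μ.map (fun x => fun i : Fin (n + 1) =>
                  (x.1 (Fin.castLE h (Fin.natAdd a i)), x.2 (Fin.castLE h (Fin.natAdd a i)))) =
                (boxMarginal (a : ℤ) n μT).withDensity (fun y => ENNReal.ofReal (f y)) ∧
              Integrable (fun y => (∑ i : Fin (n + 1), ((fderiv ℝ f y (Pi.single i ((1 : ℝ), (0 : ℝ)))) ^ 2 +
                  (fderiv ℝ f y (Pi.single i ((0 : ℝ), (1 : ℝ)))) ^ 2)) / f y)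
                (boxMarginal (a : ℤ) n μT) ∧
              ENNReal.ofReal (∫ y, (∑ i : Fin (n + 1), ((fderiv ℝ f y (Pi.single i ((1 : ℝ), (0 : ℝ)))) ^ 2 +
                  (fderiv ℝ f y (Pi.single i ((0 : ℝ), (1 : ℝ)))) ^ 2)) / f y
                ∂(boxMarginal (a : ℤ) n μT)) ≤ C * (n + 1)

/-- Statement of `stub_boxLSI` (verbatim), keyed by the registered stub name. -/
abbrev stub_boxLSI : Prop :=
    ∀ ω₂ lam β γ : ℝ, 0 < ω₂ → 0 ≤ lam → 0 ≤ β → ∀ (T : ℝ) (μT : Measure ChainConfig), 0 < T →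
      (pinnedChain ω₂ lam β γ).IsChainGibbsMeasure T μT → IsShiftInvariant μT →
        (∀ m : ℕ, Integrable (fun σ : ChainConfig => |(σ 0).1| ^ m + |(σ 0).2| ^ m) μT) →
        ∃ c : ℝ≥0∞, c ≠ ⊤ ∧ ∀ (a : ℤ) (n : ℕ) (f : (Fin (n + 1) → ℝ × ℝ) → ℝ),
          ContDiff ℝ 1 f → (∀ y, 0 < f y) →
          IsProbabilityMeasure ((boxMarginal a n μT).withDensity (fun y => ENNReal.ofReal (f y))) →
          Integrable (fun y => (∑ i : Fin (n + 1), ((fderiv ℝ f y (Pi.single i ((1 : ℝ), (0 : ℝ)))) ^ 2 +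
              (fderiv ℝ f y (Pi.single i ((0 : ℝ), (1 : ℝ)))) ^ 2)) / f y)
            (boxMarginal a n μT) →
          klDiv ((boxMarginal a n μT).withDensity (fun y => ENNReal.ofReal (f y))) (boxMarginal a n μT) ≤
            c * ENNReal.ofReal (∫ y, (∑ i : Fin (n + 1), ((fderiv ℝ f y (Pi.single i ((1 : ℝ), (0 : ℝ)))) ^ 2 +
                (fderiv ℝ f y (Pi.single i ((0 : ℝ), (1 : ℝ)))) ^ 2)) / f y
              ∂(boxMarginal a n μT))

end Registered

/-! ### Consistency: each registered statement IS its stub's type (definitionally) -/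

example : Registered.stub_temperedGibbsState := stub_temperedGibbsState
example : Registered.stub_bathFisherBudget := stub_bathFisherBudget
example : Registered.stub_fisherNoPileUp := stub_fisherNoPileUp
example : Registered.stub_boxLSI := stub_boxLSI

/-! ## The kernel-checked composition -/

/-- The push-forward of a weak steady state to a box is a probability measure. [folklore] -/
theorem isProbabilityMeasure_nessBox {N : ℕ} (μ : Measure (PhaseSpace N)) [IsProbabilityMeasure μ]
    (a n : ℕ) (h : a + (n + 1) ≤ N) :
    IsProbabilityMeasure (μ.map (fun x => fun i : Fin (n + 1) =>
      (x.1 (Fin.castLE h (Fin.natAdd a i)), x.2 (Fin.castLE h (Fin.natAdd a i))))) := by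
  refine Measure.isProbabilityMeasure_map (Measurable.aemeasurable ?_)
  exact measurable_pi_lambda _ fun i =>
    ((measurable_pi_apply _).comp measurable_fst).prodMk ((measurable_pi_apply _).comp measurable_snd)

/-- **Composition `NessRegularity_of`.** S1 → S2 → S3 → S4 → `NessRegularity` (sorry-free; concludes the route decl BY
NAME; hypotheses are the registered stubs BY NAME). Reference temperature: the mean `T = (T_L + T_R)/2`; constant `c·C`. -/
theorem NessRegularity_of (h1 : Registered.stub_temperedGibbsState) (h2 : Registered.stub_bathFisherBudget)
    (h3 : Registered.stub_fisherNoPileUp) (h4 : Registered.stub_boxLSI) :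
    Summit.AtomisticToContinuum.FouriersLaw.Theses.ParityLiouvilleSeed.NessRegularity := by
  intro ω₂ lam β γ hω hl hβ hγ T_L T_R hTL hTR
  -- the reference: a tempered shift-invariant Gibbs state at the mean temperature
  have hT : 0 < (T_L + T_R) / 2 := by positivity
  obtain ⟨μT, hG, hS, hmom⟩ := h1 ω₂ lam β γ hω hl.le hβ.le ((T_L + T_R) / 2) hT
  -- the N-uniform seed at the baths, spread through the bulk as box Fisher bounds
  have hbudget := h2 ω₂ lam β γ hω hl hβ hγ T_L T_R hTL hTR
  obtain ⟨C, hCtop, hC⟩ := h3 ω₂ lam β γ hω hl hβ hγ T_L T_R hTL hTR ((T_L + T_R) / 2) μT hT hG hS hmom hbudget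
  -- the dimension-free log-Sobolev constant of the reference
  obtain ⟨c, hctop, hLSI⟩ := h4 ω₂ lam β γ hω hl.le hβ.le ((T_L + T_R) / 2) μT hT hG hS hmom
  refine ⟨(T_L + T_R) / 2, μT, hT, hG, hS, c * C, ENNReal.mul_ne_top hctop hCtop, ?_⟩
  intro N μ hμ a n h
  obtain ⟨f, hf1, hfpos, heq, hint, hbound⟩ := hC N μ hμ a n h
  haveI : IsProbabilityMeasure μ := hμ.1
  have hprob : IsProbabilityMeasure
      ((boxMarginal (a : ℤ) n μT).withDensity (fun y => ENNReal.ofReal (f y))) := by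
    rw [← heq]
    exact isProbabilityMeasure_nessBox μ a n h
  have hkl := hLSI (a : ℤ) n f hf1 hfpos hprob hint
  rw [heq]
  calc klDiv ((boxMarginal (a : ℤ) n μT).withDensity (fun y => ENNReal.ofReal (f y))) (boxMarginal (a : ℤ) n μT)
      ≤ c * ENNReal.ofReal (∫ y, (∑ i : Fin (n + 1), ((fderiv ℝ f y (Pi.single i ((1 : ℝ), (0 : ℝ)))) ^ 2 +
              (fderiv ℝ f y (Pi.single i ((0 : ℝ), (1 : ℝ)))) ^ 2)) / f y
          ∂(boxMarginal (a : ℤ) n μT)) := hkl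
    _ ≤ c * (C * (n + 1)) := by gcongr
    _ = c * C * (n + 1) := (mul_assoc _ _ _).symm

/-- The skeleton closes the crux modulo the four stubs (instantiation; its only `sorry`s are the stubs'). -/
example : Summit.AtomisticToContinuum.FouriersLaw.Theses.ParityLiouvilleSeed.NessRegularity :=
  NessRegularity_of stub_temperedGibbsState stub_bathFisherBudget stub_fisherNoPileUp stub_boxLSI

end Summit.AtomisticToContinuum.FouriersLaw.Cruxes.NessRegularity.Birth

end
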